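import Literature.Analysis.FluidPDE.KatoLaiFormSolutionCalculus
import HarnessLib

/-!
# Kato–Lai in the periodic cylinder: Sobolev levels inside `SymL2`

Analysis/FluidPDE support file for the energy-method construction of Euler flows in the
periodic cylinder (`Literature.Analysis.FluidPDE.KatoLai1984_periodicCylinderUniformExistence`;
Kato–Lai 1984, §1 (1.3) and §5: the scale `H^m`, here on the coefficient side). All levels live
in the one Hilbert space `X = SymL2 (Fin 3)` of conjugation-symmetric coefficient families:

* `wt m k = ((1 + |k|²)^m)^{1/2}`, the level weights; `drop j = diag (wt j)⁻¹` (the inclusion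
  `H^{p+j} → H^p` on coefficients);
* `AtLevel m g F` — `F` stores `wt m · g` ("`g` read at level `m`"); uniqueness, closedness under
  limits (`AtLevel.of_tendsto`), `drop`, and the norm `‖F‖² = lat_m` of the physical field
  (`AtLevel.norm_sq_eq_latNormSq`);
* `levelOf s ε m = diag (wt m / w)` for `w = klWeight s ε`, `m ≤ s`, `ε ≠ 0`: reads an element of
  the level-`s` space at level `m` (`atLevel_embed_levelOf`); for `m < s` its symbol vanishes at
  infinity, so along a solution in duality form `t ↦ levelOf m (u t)` is **norm continuous**
  (`continuousOn_levelOf_sol`).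

Everything is proved; no named fact and no `sorry` is introduced.

## References

* T. Kato, C. Y. Lai, J. Funct. Anal. 56 (1984) 15–28, §1, §5. [KatoLai1984]
-/

noncomputable section

open MeasureTheory Set Function Filter Topology TopologicalSpace
open scoped NNReal ENNReal InnerProductSpace RealInnerProductSpace

namespace Literature.Analysis.FluidPDE

open FunctionSpaces FunctionSpaces.Torus UnitAddTorus

/-- Local notation for physical space `ℝ³ = EuclideanSpace ℝ (Fin 3)`. -/
local notation "ℝ³" => EuclideanSpace ℝ (Fin 3)

namespace PeriodicCylinder

/-! ### Level weights -/

/-- The level weight `((1 + |k|²)^m)^{1/2}`. [cite: KatoLai1984, §1 (1.3)] -/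
def wt (m : ℕ) (k : Fin 3 → ℤ) : ℝ := Real.sqrt ((1 + freqNormSq k) ^ m)

/-- `wt m k ² = (1 + |k|²)^m`. [folklore] -/
theorem wt_sq (m : ℕ) (k : Fin 3 → ℤ) : wt m k ^ 2 = (1 + freqNormSq k) ^ m :=
  Real.sq_sqrt (pow_nonneg (by linarith [freqNormSq_nonneg k]) m)

/-- `1 ≤ wt m k`. [folklore] -/
theorem one_le_wt (m : ℕ) (k : Fin 3 → ℤ) : 1 ≤ wt m k := by
  rw [wt, Real.one_le_sqrt]
  exact one_le_pow₀ (by linarith [freqNormSq_nonneg k])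

/-- `0 < wt m k`. [folklore] -/
theorem wt_pos (m : ℕ) (k : Fin 3 → ℤ) : 0 < wt m k := lt_of_lt_of_le one_pos (one_le_wt m k)

/-- `wt` is even. [folklore] -/
theorem wt_neg (m : ℕ) (k : Fin 3 → ℤ) : wt m (-k) = wt m k := by rw [wt, wt, freqNormSq_neg]

/-- `wt (a + b) = wt a · wt b`. [folklore] -/
theorem wt_add (a b : ℕ) (k : Fin 3 → ℤ) : wt (a + b) k = wt a k * wt b k := by
  rw [wt, wt, wt, pow_add, Real.sqrt_mul (pow_nonneg (by linarith [freqNormSq_nonneg k]) a)]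

/-- `wt 0 = 1`. [folklore] -/
@[simp] theorem wt_zero (k : Fin 3 → ℤ) : wt 0 k = 1 := by rw [wt, pow_zero, Real.sqrt_one]

/-- `|(wt j k)⁻¹| ≤ 1`. [folklore] -/
theorem abs_wt_inv_le (j : ℕ) (k : Fin 3 → ℤ) : |(wt j k)⁻¹| ≤ 1 := by
  rw [abs_of_pos (inv_pos.2 (wt_pos j k))]; exact inv_le_one_of_one_le₀ (one_le_wt j k)

/-- `(wt j)⁻¹` is even. [folklore] -/
theorem wt_inv_neg (j : ℕ) (k : Fin 3 → ℤ) : (wt j (-k))⁻¹ = (wt j k)⁻¹ := by rw [wt_neg]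

/-- **The inclusion of levels** `drop j = diag (wt j)⁻¹`. [folklore] -/
def drop (j : ℕ) : SymL2 (Fin 3) →L[ℝ] SymL2 (Fin 3) := SymL2.diag (fun k => (wt j k)⁻¹) (abs_wt_inv_le j) (wt_inv_neg j)

/-- Coordinates of `drop j F`. [folklore] -/
theorem drop_apply (j : ℕ) (F : SymL2 (Fin 3)) (k : Fin 3 → ℤ) : drop j F k = ((wt j k)⁻¹ : ℂ) • F k := by
  rw [drop, SymL2.diag_apply]; norm_cast

/-- `‖drop j F‖ ≤ ‖F‖`. [folklore] -/
theorem norm_drop_le (j : ℕ) (F : SymL2 (Fin 3)) : ‖drop j F‖ ≤ ‖F‖ := by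
  have := SymL2.norm_diag_le (fun k => (wt j k)⁻¹) (abs_wt_inv_le j) (wt_inv_neg j) F
  simpa [drop] using this

/-! ### Reading a coefficient family at a level -/

/-- **`F` is `g` read at level `m`**: `F k = wt m k · g k`. [folklore] -/
def AtLevel (m : ℕ) (g F : SymL2 (Fin 3)) : Prop := ∀ k, F k = ((wt m k : ℝ) : ℂ) • g k

/-- At level `0`, `g` is itself. [folklore] -/
theorem atLevel_zero (g : SymL2 (Fin 3)) : AtLevel 0 g g := fun k => by simp

/-- Uniqueness of the level-`m` reading. [folklore] -/
theorem AtLevel.unique {m : ℕ} {g F F' : SymL2 (Fin 3)} (h : AtLevel m g F) (h' : AtLevel m g F') : F = F' :=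
  SymL2.ext fun k => by rw [h k, h' k]

/-- Injectivity: the level-`m` reading determines `g`. [folklore] -/
theorem AtLevel.eq_of_eq {m : ℕ} {g g' F : SymL2 (Fin 3)} (h : AtLevel m g F) (h' : AtLevel m g' F) : g = g' :=
  SymL2.ext fun k => by
    have e := (h k).symm.trans (h' k)
    have hw : ((wt m k : ℝ) : ℂ) ≠ 0 := by exact_mod_cast (wt_pos m k).ne'
    exact smul_right_injective _ hw e

/-- Dropping levels: if `F` is `g` at level `p + j` then `drop j F` is `g` at level `p`. [folklore] -/
theorem AtLevel.drop {p j : ℕ} {g F : SymL2 (Fin 3)} (h : AtLevel (p + j) g F) : AtLevel p g (drop j F) := fun k => by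
  rw [drop_apply, h k, smul_smul, wt_add]
  congr 1
  have hw : ((wt j k : ℝ) : ℂ) ≠ 0 := by exact_mod_cast (wt_pos j k).ne'
  push_cast
  field_simp

/-- Linearity: sums. [folklore] -/
theorem AtLevel.add {m : ℕ} {g g' F F' : SymL2 (Fin 3)} (h : AtLevel m g F) (h' : AtLevel m g' F') : AtLevel m (g + g') (F + F') :=
  fun k => by rw [SymL2.add_apply, SymL2.add_apply, h k, h' k, smul_add]

/-- Linearity: differences. [folklore] -/
theorem AtLevel.sub {m : ℕ} {g g' F F' : SymL2 (Fin 3)} (h : AtLevel m g F) (h' : AtLevel m g' F') : AtLevel m (g - g') (F - F') :=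
  fun k => by rw [SymL2.sub_apply, SymL2.sub_apply, h k, h' k, smul_sub]

/-- Linearity: real multiples. [folklore] -/
theorem AtLevel.smul {m : ℕ} {g F : SymL2 (Fin 3)} (h : AtLevel m g F) (c : ℝ) : AtLevel m (c • g) (c • F) :=
  fun k => by rw [SymL2.smul_apply, SymL2.smul_apply, h k, smul_comm]

/-- **Closedness**: limits of level-`m` readings are level-`m` readings. [folklore] -/
theorem AtLevel.of_tendsto {m : ℕ} {g F : ℕ → SymL2 (Fin 3)} {gl Fl : SymL2 (Fin 3)} (h : ∀ n, AtLevel m (g n) (F n))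
    (hg : Tendsto g atTop (𝓝 gl)) (hF : Tendsto F atTop (𝓝 Fl)) : AtLevel m gl Fl := fun k => by
  have h1 : Tendsto (fun n => F n k) atTop (𝓝 (Fl k)) := ((SymL2.continuous_apply k).tendsto _).comp hF
  have h2 : Tendsto (fun n => ((wt m k : ℝ) : ℂ) • g n k) atTop (𝓝 (((wt m k : ℝ) : ℂ) • gl k)) :=
    (((SymL2.continuous_apply k).tendsto _).comp hg).const_smul _
  exact tendsto_nhds_unique h1 (h2.congr fun n => (h n k).symm)

/-- **The norm at level `m` is the lattice energy** of the physical field: for a smooth torus field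
`U`, if `F` is `toL2 U` at level `m` then `‖F‖² = lat_m(U)`. [folklore] -/
theorem AtLevel.norm_sq_eq_latNormSq {m : ℕ} {U : UnitAddTorus (Fin 3) → ℝ³} (hU : IsSmooth U) {F : SymL2 (Fin 3)}
    (h : AtLevel m (toL2 hU) F) : ‖F‖ ^ 2 = Torus.latNormSq m U := by
  have hs := SymL2.hasSum_norm_sq F
  unfold Torus.latNormSq
  rw [← hs.tsum_eq]
  refine tsum_congr fun k => ?_
  rw [h k, SymL2.ofSmooth_apply, norm_smul, Complex.norm_real, Real.norm_of_nonneg (wt_pos m k).le, mul_pow, wt_sq]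
  simp

/-! ### Reading the level-`s` space at level `m ≤ s` -/

section LevelOf

variable (s : ℕ) {ε : ℝ} {m : ℕ}

/-- The symbol `wt m / w`. [folklore] -/
def levelOfSymbol (s : ℕ) (ε : ℝ) (m : ℕ) (k : Fin 3 → ℤ) : ℝ := wt m k * (klWeight s ε k)⁻¹

/-- `0 < levelOfSymbol`. [folklore] -/
theorem levelOfSymbol_pos (k : Fin 3 → ℤ) : 0 < levelOfSymbol s ε m k := mul_pos (wt_pos m k) (inv_pos.2 (klWeight_pos s ε k))

/-- `|wt m / w| ≤ 2^{s-1} / |ε|` for `m ≤ s`. [folklore] -/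
theorem abs_levelOfSymbol_le (hε : ε ≠ 0) (hm : m ≤ s) (hs : 1 ≤ s) (k : Fin 3 → ℤ) : |levelOfSymbol s ε m k| ≤ 2 ^ (s - 1) / |ε| := by
  have hε' : 0 < |ε| := abs_pos.2 hε
  rw [abs_of_pos (levelOfSymbol_pos s k), levelOfSymbol, mul_inv_le_iff₀ (klWeight_pos s ε k)]
  have hk1 : (1 : ℝ) ≤ 1 + freqNormSq k := by linarith [freqNormSq_nonneg k]
  have hε2 : 0 < ε ^ 2 := by rw [← sq_abs]; exact pow_pos hε' 2
  have h2 := sq_mul_latWeight_le_klWeight_sq hs ε k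
  have h1 : wt m k ^ 2 ≤ (2 ^ (s - 1) / |ε| * klWeight s ε k) ^ 2 := by
    rw [wt_sq]
    have e : (2 ^ (s - 1) / |ε| * klWeight s ε k) ^ 2 = 4 ^ (s - 1) * klWeight s ε k ^ 2 / ε ^ 2 := by
      rw [mul_pow, div_pow, sq_abs, ← pow_mul, show (2 : ℝ) ^ ((s - 1) * 2) = 4 ^ (s - 1) by
        rw [mul_comm, pow_mul]; norm_num]
      ring
    rw [e, le_div_iff₀ hε2]
    calc (1 + freqNormSq k) ^ m * ε ^ 2 ≤ (1 + freqNormSq k) ^ s * ε ^ 2 :=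
          mul_le_mul_of_nonneg_right (pow_le_pow_right₀ hk1 hm) hε2.le
      _ = ε ^ 2 * (1 + freqNormSq k) ^ s := mul_comm _ _
      _ ≤ 4 ^ (s - 1) * klWeight s ε k ^ 2 := h2
  have hK : 0 ≤ 2 ^ (s - 1) / |ε| * klWeight s ε k := mul_nonneg (div_nonneg (pow_nonneg (by norm_num) _) hε'.le) (klWeight_pos s ε k).le
  exact (pow_le_pow_iff_left₀ (wt_pos m k).le hK two_ne_zero).1 h1

/-- `levelOfSymbol` is even. [folklore] -/
theorem levelOfSymbol_neg (k : Fin 3 → ℤ) : levelOfSymbol s ε m (-k) = levelOfSymbol s ε m k := by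
  rw [levelOfSymbol, levelOfSymbol, wt_neg, (isWeight_klWeight s ε).even]

/-- **Reading at level `m ≤ s`**: `diag (wt m / w)`. [folklore] -/
def levelOf (hε : ε ≠ 0) (hm : m ≤ s) (hs : 1 ≤ s) : SymL2 (Fin 3) →L[ℝ] SymL2 (Fin 3) :=
  SymL2.diag (levelOfSymbol s ε m) (abs_levelOfSymbol_le s hε hm hs) (levelOfSymbol_neg s)

/-- `levelOf f` is `i f` at level `m`. [folklore] -/
theorem atLevel_embed_levelOf (hε : ε ≠ 0) (hm : m ≤ s) (hs : 1 ≤ s) (f : SymL2 (Fin 3)) :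
    AtLevel m (embed s ε f) (levelOf s hε hm hs f) := fun k => by
  rw [levelOf, SymL2.diag_apply, embed_apply, smul_smul, levelOfSymbol]
  push_cast
  ring_nf

/-- **For `m < s` the symbol vanishes at infinity** (`wt m / w ≤ C (1 + |k|²)^{(m-s)/2}`). [folklore] -/
theorem vanishingSymbol_levelOfSymbol (hε : ε ≠ 0) (hlt : m < s) : SymL2.VanishingSymbol (levelOfSymbol s ε m) := by
  intro δ hδ
  have hs : 1 ≤ s := by omega
  have hε' : 0 < |ε| := abs_pos.2 hε
  set C : ℝ := 4 ^ (s - 1) / ε ^ 2 with hC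
  have hε2 : 0 < ε ^ 2 := by rw [← sq_abs]; exact pow_pos hε' 2
  have hCpos : 0 < C := by positivity
  obtain ⟨N, hN⟩ := exists_nat_gt (C / δ ^ 2)
  refine ⟨N, fun k hk => ?_⟩
  rw [mem_freqBall, not_le] at hk
  rw [abs_of_pos (levelOfSymbol_pos s k)]
  have hk1 : (1 : ℝ) ≤ 1 + freqNormSq k := by linarith [freqNormSq_nonneg k]
  have hw := klWeight_pos s ε k
  -- `symbol² = (1+|k|²)^m / w² ≤ C / (1+|k|²)` since `(1+|k|²)^{m+1} ≤ (1+|k|²)^s ≤ C w²`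
  have hsq : levelOfSymbol s ε m k ^ 2 ≤ C / (1 + freqNormSq k) := by
    rw [levelOfSymbol, mul_pow, inv_pow, wt_sq, le_div_iff₀ (by linarith)]
    have h2 := sq_mul_latWeight_le_klWeight_sq hs ε k
    have h3 : (1 + freqNormSq k) ^ m * (1 + freqNormSq k) ≤ (1 + freqNormSq k) ^ s := by
      rw [← pow_succ]; exact pow_le_pow_right₀ hk1 (by omega)
    rw [show (1 + freqNormSq k) ^ m * (klWeight s ε k ^ 2)⁻¹ * (1 + freqNormSq k) =
      ((1 + freqNormSq k) ^ m * (1 + freqNormSq k)) / klWeight s ε k ^ 2 by field_simp]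
    rw [div_le_iff₀ (pow_pos hw 2), hC, div_mul_eq_mul_div, le_div_iff₀ hε2]
    nlinarith
  have hlt' : C / (1 + freqNormSq k) < δ ^ 2 := by
    rw [div_lt_iff₀ (by linarith)]
    have hN' : C / δ ^ 2 < 1 + freqNormSq k := by
      have : (N : ℝ) ^ 2 < freqNormSq k := hk
      have hN0 : (0 : ℝ) ≤ N := Nat.cast_nonneg N
      nlinarith
    rwa [div_lt_iff₀ (by positivity), mul_comm] at hN'
  exact ((pow_lt_pow_iff_left₀ (levelOfSymbol_pos s k).le hδ.le two_ne_zero).1 (hsq.trans_lt hlt')).le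

/-- Sequences converging within `[0, T]`: a tail lies in `[0, T]` (private copy of the lemma of
`KatoLaiLowerEnergy`, which is not upstream of this file). [folklore] -/
private theorem exists_shift_mem_of_tendsto_nhdsWithin_loc {T : ℝ} {x : ℕ → ℝ} {t₀ : ℝ} (hx : Tendsto x atTop (𝓝[Icc 0 T] t₀)) :
    ∃ N : ℕ, (∀ n, x (n + N) ∈ Icc 0 T) ∧ Tendsto (fun n => x (n + N)) atTop (𝓝 t₀) := by
  rw [tendsto_nhdsWithin_iff] at hx
  obtain ⟨N, hN⟩ := eventually_atTop.1 hx.2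
  exact ⟨N, fun n => hN _ (Nat.le_add_left N n), hx.1.comp (tendsto_add_atTop_nat N)⟩

/-- **Norm continuity below the top level**: along a solution in duality form of the level-`s`
problem, `t ↦ levelOf m (u t)` is continuous on `[0, T]` for `m < s`. [cite: KatoLai1984, §5 (p. 22)] -/
theorem continuousOn_levelOf_sol {L : ℝ} (hL : 0 < L) (hε : ε ≠ 0) (hm : m ≤ s) (hs : 1 ≤ s) (hlt : m < s)
    {φ : SymL2 (Fin 3)} {T : ℝ} {u : ℝ → SymL2 (Fin 3)} (hu : KatoLai.IsFormSolution (embed s ε) (klForm hL s ε) φ T u) :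
    ContinuousOn (fun t => levelOf s hε hm hs (u t)) (Icc 0 T) := by
  intro t' ht'
  rw [ContinuousWithinAt, tendsto_iff_seq_tendsto]
  intro t ht
  obtain ⟨N, hmem, htt⟩ := exists_shift_mem_of_tendsto_nhdsWithin_loc ht
  have hweak : SymL2.WeakTendsto (fun n => u (t (n + N))) (u t') := weakTendsto_sol hL s ε hu hmem ht' htt
  have h := hweak.tendsto_diag_of_vanishing (abs_levelOfSymbol_le s hε hm hs) (levelOfSymbol_neg s)
    (vanishingSymbol_levelOfSymbol s hε hlt)
  exact (tendsto_add_atTop_iff_nat N).1 h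

end LevelOf

end PeriodicCylinder

end Literature.Analysis.FluidPDE
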